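import Mathlib
import Summits.CriticalPhenomena.PercolationContinuityZ3.Theorems.PercNearOneGluingNoHeavyLowerTailOrientedAntipodalHallEnlargedCalculus
import Summits.CriticalPhenomena.PercolationContinuityZ3.Theorems.PercNearOneGluingNoHeavyLowerTailOrderedDifferences
import Summits.CriticalPhenomena.PercolationContinuityZ3.Theorems.PercNearOneGluingNoHeavyLowerTailOrientedAntipodalHallEnlargedTwoGroup

/-!
# Two-sided enlargement and ORDERED Marica–Schönheim: a linear-algebra-free certificate for the oriented antipodal Hall theorem

Helper file for crux `stmt-CriticalPhenomena-4575` (`NoHeavyLowerTail`, route `PercNearOneGluingNoHeavy`),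
new-inequality factory seat `prim-ineq-gen-3` (gen 16).  Everything here is PROVED.

Setting of `…OrientedAntipodalHall`: `f : Finset α → Lab k` monotone, ground set `S`, a family `D` of antipodal bads
(`f X = C_{i X}`, `f (S \ X) = C_{j X}`), good sets (`f U = A`, `f (S \ U) = B`).

**The socket (`card_le_card_goods_above_of_orderedTwoSided`).**  Represent every bad `X` by a member `M X` and adjoin
an auxiliary family `P` of *pseudo-sets*, each disjoint from some bad of `D`.  If the family `M(D) ∪ P` carries ranks
(into any linear order) such that, along the ranks, no element is contained in a later one and every difference
`U \ V` (`U` not later than `V`) is either a pseudo-set or a *certified co-good* (`f = B`, complement `A`, disjoint from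
a bad of `D`), then the ORDERED Marica–Schönheim inequality (`OrderedDifferences.card_le_card_of_rank`) gives
`#D + #P ≤ #(co-goods) + #P`, i.e. `#D ≤ #goods above D`.  No linear algebra, no rigidity theorem.

**The label-level certificate (`card_le_card_goods_above_of_twoSidedCert`, SDR form
`exists_injective_good_above_of_twoSidedCert`, table form `exists_injective_good_above_of_twoSidedTable`).**  Members
may be PLAIN (`M X = X`) or COMPLEMENTED (`M X = S \ X`) per type; the pseudo-sets are the TWO-SIDED enlargement
`Ψ_R = {E : f E = B, f (S \ E) = C_r, r ∈ R}` and `Φ_{S₀} = {F : f F = C_s, f (S \ F) = A, s ∈ S₀}` (each disjoint from a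
bad); ranks are block ranks of types / pseudo-classes refined by set size.  The hypotheses are decidable statements
about labels (checked by `decide` for a concrete type class).  Reach (memo FINDINGS-gen16.md in
`run/shared/lean/prim/prim-ineq-gen-3/`): all 6 opposite-free classes on three petals — the cyclic triangle with
`D₂₀ᶜ ≺ Φ₀ ≺ D₀₁ᶜ ≺ D₁₂` (plain last block), previously obtained from the TRIPLE-0 rigidity theorem —, all 41 on four
petals (including the four tournaments of `…TournamentTT4/Strong/C3Source/C3Sink`), 578 of the 581 on five petals and
21 of the 56 six-vertex tournaments: exactly the reach of the two-group certificates of gen 13, by ordered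
Marica–Schönheim alone.  At INSTANCE level (pseudo-sets and order chosen per labeling) the certificate exists in every
tested instance of the three open five-petal tournaments (FINDINGS-gen16.md).  (prim-ineq-gen-3 gen 16, 2026-08-22.)
-/

namespace Summit.CriticalPhenomena.PercolationContinuityZ3.Theorems

namespace OrientedAntipodalHall

open Finset AntipodalStrongHarris AntipodalStrongHarris.Lab OrderedDifferences
open scoped FinsetFamily

variable {α : Type*} [DecidableEq α] {k : ℕ}

/-- **Socket: an ordered two-sided family certifies the Hall count.**  `f` monotone, `D` a family of antipodal bads of
`S` (`f X = C_{i X} ≠ C_{j X} = f (S \ X)`), `M X` a member set for each bad and `P` a finite family of pseudo-sets.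
Suppose ranks `ρM` (on bads) and `ρP` (on pseudo-sets) into a linear order are given such that for every two distinct
elements `U, V` of the family `M(D) ∪ P` with `rank U ≤ rank V`: `U ⊄ V`, and `U \ V` is a pseudo-set or a certified
co-good (a subset of `S` with label `B`, complement label `A`, disjoint from some bad of `D`).  Then
`#D ≤ #{goods above D}`. -/
theorem card_le_card_goods_above_of_orderedTwoSided (S : Finset α) {f : Finset α → Lab k}
    (hf : ∀ ⦃X Y : Finset α⦄, X ⊆ Y → f X ≤ f Y) (D : Finset (Finset α)) (i j : Finset α → Fin k)
    (hDS : ∀ X ∈ D, X ⊆ S) (hDi : ∀ X ∈ D, f X = petal (i X)) (hDj : ∀ X ∈ D, f (S \ X) = petal (j X))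
    (hij : ∀ X ∈ D, i X ≠ j X) (M : Finset α → Finset α) (P : Finset (Finset α))
    {β : Type*} [LinearOrder β] (ρM ρP : Finset α → β)
    (hMM : ∀ X ∈ D, ∀ X' ∈ D, X ≠ X' → ρM X ≤ ρM X' → ¬ M X ⊆ M X' ∧ (M X \ M X' ∈ P ∨
      (M X \ M X' ⊆ S ∧ f (M X \ M X') = bot ∧ f (S \ (M X \ M X')) = top ∧ ∃ Y ∈ D, Disjoint (M X \ M X') Y)))
    (hMP : ∀ X ∈ D, ∀ E ∈ P,
      (ρM X ≤ ρP E → ¬ M X ⊆ E ∧ (M X \ E ∈ P ∨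
        (M X \ E ⊆ S ∧ f (M X \ E) = bot ∧ f (S \ (M X \ E)) = top ∧ ∃ Y ∈ D, Disjoint (M X \ E) Y))) ∧
      (ρP E ≤ ρM X → ¬ E ⊆ M X ∧ (E \ M X ∈ P ∨
        (E \ M X ⊆ S ∧ f (E \ M X) = bot ∧ f (S \ (E \ M X)) = top ∧ ∃ Y ∈ D, Disjoint (E \ M X) Y))))
    (hPP : ∀ E ∈ P, ∀ E' ∈ P, E ≠ E' → ρP E ≤ ρP E' → ¬ E ⊆ E' ∧ (E \ E' ∈ P ∨
      (E \ E' ⊆ S ∧ f (E \ E') = bot ∧ f (S \ (E \ E')) = top ∧ ∃ Y ∈ D, Disjoint (E \ E') Y))) :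
    #D ≤ #{U ∈ S.powerset | f U = top ∧ f (S \ U) = bot ∧ ∃ X ∈ D, X ⊆ U} := by
  classical
  rcases D.eq_empty_or_nonempty with rfl | ⟨X₀, hX₀⟩
  · simp
  have hbot : f ∅ = bot :=
    eq_bot_of_le_petal (hij X₀ hX₀) ((hDi X₀ hX₀) ▸ hf (empty_subset _)) ((hDj X₀ hX₀) ▸ hf (empty_subset _))
  have htop : f S = top :=
    eq_top_of_petal_le (hij X₀ hX₀) ((hDi X₀ hX₀) ▸ hf (hDS X₀ hX₀)) ((hDj X₀ hX₀) ▸ hf sdiff_subset)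
  set K : Finset (Finset α) := {F ∈ S.powerset | f F = bot ∧ f (S \ F) = top ∧ ∃ Y ∈ D, Disjoint F Y} with hK
  have hKmem : ∀ Z, (Z ⊆ S ∧ f Z = bot ∧ f (S \ Z) = top ∧ ∃ Y ∈ D, Disjoint Z Y) → Z ∈ K ∪ P := by
    rintro Z ⟨hZS, hZb, hZt, hZY⟩
    exact mem_union_left _ (by rw [hK, mem_filter, mem_powerset]; exact ⟨hZS, hZb, hZt, hZY⟩)
  have hempty : (∅ : Finset α) ∈ K ∪ P := by
    refine hKmem ∅ ⟨empty_subset _, hbot, ?_, X₀, hX₀, disjoint_empty_left _⟩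
    rw [sdiff_empty]; exact htop
  -- the indexed family: members of `D` and pseudo-sets
  let A : D ⊕ P → Finset α := Sum.elim (fun X => M X.1) (fun E => E.1)
  let r : D ⊕ P → β := Sum.elim (fun X => ρM X.1) (fun E => ρP E.1)
  have hA : ∀ ⦃x y : D ⊕ P⦄, x ≠ y → r x ≤ r y → ¬ A x ⊆ A y := by
    rintro (⟨X, hX⟩ | ⟨E, hE⟩) (⟨X', hX'⟩ | ⟨E', hE'⟩) hne hle
    · have hXX : X ≠ X' := fun h => hne (by subst h; rfl)
      exact (hMM X hX X' hX' hXX hle).1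
    · exact ((hMP X hX E' hE').1 hle).1
    · exact ((hMP X' hX' E hE).2 hle).1
    · have hEE : E ≠ E' := fun h => hne (by subst h; rfl)
      exact (hPP E hE E' hE' hEE hle).1
  have hT : ∀ ⦃x y : D ⊕ P⦄, r x ≤ r y → A x \ A y ∈ K ∪ P := by
    intro x y hle
    by_cases hxy : x = y
    · subst hxy; rw [sdiff_self]; exact hempty
    rcases x with ⟨X, hX⟩ | ⟨E, hE⟩ <;> rcases y with ⟨X', hX'⟩ | ⟨E', hE'⟩
    · have hXX : X ≠ X' := fun h => hxy (by subst h; rfl)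
      rcases (hMM X hX X' hX' hXX hle).2 with h | h
      · exact mem_union_right _ h
      · exact hKmem _ h
    · rcases ((hMP X hX E' hE').1 hle).2 with h | h
      · exact mem_union_right _ h
      · exact hKmem _ h
    · rcases ((hMP X' hX' E hE).2 hle).2 with h | h
      · exact mem_union_right _ h
      · exact hKmem _ h
    · have hEE : E ≠ E' := fun h => hxy (by subst h; rfl)
      rcases (hPP E hE E' hE' hEE hle).2 with h | h
      · exact mem_union_right _ h
      · exact hKmem _ h
  have hmain := card_le_card_of_rank A r hA (K ∪ P) hT
  have hcard : Fintype.card (D ⊕ P) = #D + #P := by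
    rw [Fintype.card_sum, Fintype.card_coe, Fintype.card_coe]
  have hDK : #D ≤ #K := by
    have h := card_union_le K P
    omega
  -- `K` injects into the goods above `D` by complementation
  have hKS : ∀ F ∈ K, F ⊆ S := by
    intro F hF
    rw [hK, mem_filter, mem_powerset] at hF
    exact hF.1
  have hinjK : Set.InjOn (fun F => S \ F) (K : Set (Finset α)) := by
    intro F₁ hF₁ F₂ hF₂ h
    have h₁ := Finset.sdiff_sdiff_eq_self (hKS F₁ hF₁)
    have h₂ := Finset.sdiff_sdiff_eq_self (hKS F₂ hF₂)
    simp only at h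
    rw [← h₁, ← h₂, h]
  have himg : K.image (fun F => S \ F) ⊆
      {U ∈ S.powerset | f U = top ∧ f (S \ U) = bot ∧ ∃ X ∈ D, X ⊆ U} := by
    intro U hU
    obtain ⟨F, hF, rfl⟩ := mem_image.mp hU
    have hFS := hKS F hF
    rw [hK, mem_filter] at hF
    obtain ⟨-, hFbot, hFtop, X, hX, hFX⟩ := hF
    rw [mem_filter, mem_powerset, Finset.sdiff_sdiff_eq_self hFS]
    refine ⟨sdiff_subset, hFtop, hFbot, X, hX, ?_⟩
    intro a ha
    exact mem_sdiff.mpr ⟨hDS X hX ha, fun haF => disjoint_left.mp hFX haF ha⟩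
  calc #D ≤ #K := hDK
    _ = #(K.image fun F => S \ F) := (card_image_of_injOn hinjK).symm
    _ ≤ #{U ∈ S.powerset | f U = top ∧ f (S \ U) = bot ∧ ∃ X ∈ D, X ⊆ U} := card_le_card himg


section TwoSided

variable (S : Finset α) {f : Finset α → Lab k} (D : Finset (Finset α)) (R S₀ : Finset (Fin k))

/-- **Label calculus for the two-sided enlargement.**  A subset `Z ⊆ S` disjoint from a bad of `D` whose set-label is
`B` or a petal of `S₀`, whose complement-label is `A` or a petal of `R`, and not both petals, is a pseudo-set of the
two-sided enlargement `P = Ψ_R ∪ Φ_{S₀}` or a certified co-good. -/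
theorem mem_twoSided_or_cogood (P : Finset (Finset α))
    (hP : P = {E ∈ S.powerset | (∃ Y ∈ D, Disjoint E Y) ∧
      ((f E = bot ∧ ∃ r ∈ R, f (S \ E) = petal r) ∨ (f (S \ E) = top ∧ ∃ s ∈ S₀, f E = petal s))})
    {Z : Finset α} (hZS : Z ⊆ S) (hZY : ∃ Y ∈ D, Disjoint Z Y)
    (hlo : f Z = bot ∨ ∃ s ∈ S₀, f Z = petal s) (hup : f (S \ Z) = top ∨ ∃ r ∈ R, f (S \ Z) = petal r)
    (hnb : f Z = bot ∨ f (S \ Z) = top) :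
    Z ∈ P ∨ (Z ⊆ S ∧ f Z = bot ∧ f (S \ Z) = top ∧ ∃ Y ∈ D, Disjoint Z Y) := by
  rcases hlo with hb | ⟨s, hs, hZs⟩
  · rcases hup with ht | ⟨r, hr, hZr⟩
    · exact Or.inr ⟨hZS, hb, ht, hZY⟩
    · left
      rw [hP, mem_filter, mem_powerset]
      exact ⟨hZS, hZY, Or.inl ⟨hb, r, hr, hZr⟩⟩
  · have ht : f (S \ Z) = top := by
      rcases hnb with h | h
      · rw [hZs] at h; exact absurd h (by simp)
      · exact h
    left
    rw [hP, mem_filter, mem_powerset]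
    exact ⟨hZS, hZY, Or.inr ⟨ht, s, hs, hZs⟩⟩

end TwoSided

/-- **Socket, SDR form.**  If EVERY sub-family of `D` admits an ordered two-sided certificate (members `M`, pseudo-sets
`P`, ranks `ρM`, `ρP` into `ℕ`, with the conditions of `card_le_card_goods_above_of_orderedTwoSided`), then the members of
`D` have DISTINCT good representatives above them (Hall).  This is the entry point for instance-level certificates. -/
theorem exists_injective_good_above_of_orderedTwoSided (S : Finset α) {f : Finset α → Lab k}
    (hf : ∀ ⦃X Y : Finset α⦄, X ⊆ Y → f X ≤ f Y) (D : Finset (Finset α)) (i j : Finset α → Fin k)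
    (hDS : ∀ X ∈ D, X ⊆ S) (hDi : ∀ X ∈ D, f X = petal (i X)) (hDj : ∀ X ∈ D, f (S \ X) = petal (j X))
    (hij : ∀ X ∈ D, i X ≠ j X)
    (hcert : ∀ D' ⊆ D, ∃ (M : Finset α → Finset α) (P : Finset (Finset α)) (ρM ρP : Finset α → ℕ),
      (∀ X ∈ D', ∀ X' ∈ D', X ≠ X' → ρM X ≤ ρM X' → ¬ M X ⊆ M X' ∧ (M X \ M X' ∈ P ∨
        (M X \ M X' ⊆ S ∧ f (M X \ M X') = bot ∧ f (S \ (M X \ M X')) = top ∧ ∃ Y ∈ D', Disjoint (M X \ M X') Y))) ∧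
      (∀ X ∈ D', ∀ E ∈ P,
        (ρM X ≤ ρP E → ¬ M X ⊆ E ∧ (M X \ E ∈ P ∨
          (M X \ E ⊆ S ∧ f (M X \ E) = bot ∧ f (S \ (M X \ E)) = top ∧ ∃ Y ∈ D', Disjoint (M X \ E) Y))) ∧
        (ρP E ≤ ρM X → ¬ E ⊆ M X ∧ (E \ M X ∈ P ∨
          (E \ M X ⊆ S ∧ f (E \ M X) = bot ∧ f (S \ (E \ M X)) = top ∧ ∃ Y ∈ D', Disjoint (E \ M X) Y)))) ∧
      (∀ E ∈ P, ∀ E' ∈ P, E ≠ E' → ρP E ≤ ρP E' → ¬ E ⊆ E' ∧ (E \ E' ∈ P ∨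
        (E \ E' ⊆ S ∧ f (E \ E') = bot ∧ f (S \ (E \ E')) = top ∧ ∃ Y ∈ D', Disjoint (E \ E') Y)))) :
    ∃ φ : D → Finset α, Function.Injective φ ∧
      ∀ X : D, (X : Finset α) ⊆ φ X ∧ φ X ⊆ S ∧ f (φ X) = top ∧ f (S \ φ X) = bot := by
  classical
  let t : D → Finset (Finset α) := fun X =>
    {U ∈ S.powerset | f U = top ∧ f (S \ U) = bot ∧ (X : Finset α) ⊆ U}
  have hHall : ∀ s : Finset D, #s ≤ #(s.biUnion t) := by
    intro s
    set D' : Finset (Finset α) := s.map (Function.Embedding.subtype _) with hD'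
    have hD'sub : ∀ X ∈ D', X ∈ D := by
      intro X hX
      obtain ⟨x, -, rfl⟩ := mem_map.mp hX
      exact x.2
    have hcard : #s = #D' := (card_map _).symm
    obtain ⟨M, P, ρM, ρP, hMM, hMP, hPP⟩ := hcert D' (fun X hX => hD'sub X hX)
    have hle := card_le_card_goods_above_of_orderedTwoSided S hf D' i j (fun X hX => hDS X (hD'sub X hX))
      (fun X hX => hDi X (hD'sub X hX)) (fun X hX => hDj X (hD'sub X hX)) (fun X hX => hij X (hD'sub X hX))
      M P ρM ρP hMM hMP hPP
    have hgoods : {U ∈ S.powerset | f U = top ∧ f (S \ U) = bot ∧ ∃ X ∈ D', X ⊆ U} ⊆ s.biUnion t := by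
      intro U hU
      rw [mem_filter, mem_powerset] at hU
      obtain ⟨hUS, hUtop, hUbot, X, hX, hXU⟩ := hU
      obtain ⟨x, hx, rfl⟩ := mem_map.mp hX
      rw [mem_biUnion]
      refine ⟨x, hx, ?_⟩
      simp only [t, mem_filter, mem_powerset]
      exact ⟨hUS, hUtop, hUbot, hXU⟩
    calc #s = #D' := hcard
      _ ≤ #{U ∈ S.powerset | f U = top ∧ f (S \ U) = bot ∧ ∃ X ∈ D', X ⊆ U} := hle
      _ ≤ #(s.biUnion t) := card_le_card hgoods
  obtain ⟨φ, hφinj, hφ⟩ := (all_card_le_biUnion_card_iff_exists_injective t).mp hHall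
  refine ⟨φ, hφinj, fun X => ?_⟩
  have hX := hφ X
  simp only [t, mem_filter, mem_powerset] at hX
  exact ⟨hX.2.2.2, hX.1, hX.2.1, hX.2.2.1⟩

end OrientedAntipodalHall

end Summit.CriticalPhenomena.PercolationContinuityZ3.Theorems
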